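import Summits.BirchSwinnertonDyer.BirchSwinnertonDyer.Theorems.CMKolyvaginAtInertTwoCMExactDescentAtTwo
import Summits.BirchSwinnertonDyer.BirchSwinnertonDyer.Theorems.CMKolyvaginAtInertTwoGenusDefectDeepWitnessAtTwo
import Summits.BirchSwinnertonDyer.BirchSwinnertonDyer.Theorems.CMKolyvaginAtInertTwoCMPrimitiveSupplyAtInertTwoOfKolyvaginConjecture
import Literature.NumberTheory.EllipticCurves.BSDQuadraticDescentTorsionOddPartProofs
import HarnessLib

/-!
# Route `CMKolyvaginAtInertTwo`, crux `CMKolyvaginExactAtInertTwo` (stmt-BirchSwinnertonDyer-24277) —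
# BSD-CONSISTENCY OF THE GENUS DEFECT: `BSD₂(E) ∧ BSD₂(E^{(d_K)}) ⟹ #Ш(E_K)(2) = 2^{2M₀}` for EVERY admissible `K` (the crux's value,
# whatever `Σ`), hence under BSD₂ NO level-4 Gross witness exists when `Σ ≥ 3`

Seat `bsd-line-cmk2-p1` g21 (cell `bsd-print-cf2`), `--supports stmt-BirchSwinnertonDyer-24277` (helper; closes nothing by name).
THEOREMS ONLY (no definition, no named fact, no `sorry`).  BSD is NOT proved by any of this — on the contrary, `BSDp W 2` is a HYPOTHESIS of
every theorem here: these are CONSISTENCY statements that say what the conjecture forces on the route's objects, for the planner (which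
restatement of 24277 is meaningful) and for the refuters (what a numerical deep witness would mean).

`Σ := Σ_{q ∣ d_K} ([(Δ/q) = −1] + 2·[(Δ/q) = 1 ∧ a_q even])` (g15/g18; `= ord₂ C(W^{(d_K)})`).  g20's landed
`KolyvaginGenusTwo.card_primaryComponent_sha_two_baseChange_mul_two_eq_of_grossWitness_of_printedInputs` gives, from a level-`4` Gross witness,
`#Ш(E_K)(2)·2 = 2^{2M₀+Σ}` and its docstring calls this «the BSD-predicted value».  The kernel says otherwise:

* `card_primaryComponent_sha_two_baseChange_eq_pow_of_bsdp_of_printedInputs` — g0's EXACT descent read backwards: for `W` globally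
  minimal with `ρ̄_{E,2}` onto, `r_an = 1`, odd Tamagawa product, `K` imaginary quadratic with odd `d_K ≠ −3` and Heegner, a frame with ODD
  Manin constant `Dt.c`, `y_K = P(1)` non-torsion with exact exponent `M₀`, and a globally minimal twin `Wd ≅ W^{(d_K)}`:
  **`BSDp Wd 2 → BSDp W 2 → #Ш(E_K)[2^∞] = 2^{2M₀}`**, modulo GZ / GZK / modularity / Milne — by g0's `#Ш_an(W ⊗ K) = 4I²/(c²·w_K²·(∏c_ℓ)²)`
  (`CMExactDescent.shaAnOverC_baseChange_eq_of_heegner`), `ord₂ = 2M₀`, and `AdditivePotMult.missingPPartOverCAt_baseChange_iff_bsdp`.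
  So the crux's `2^{2M₀}` IS the BSD value for every `Σ`, and g18's «BSD for the pair predicts `a + b = 2M₀ + 1 − Σ`» is the consistent reading.
* `sum_defect_eq_one_of_bsdp_of_grossWitness_of_printedInputs` — with g20's equality: **`BSDp Wd 2 → BSDp W 2 →` (level-4 Gross witness)
  `→ Σ = 1`** on the habitat (CM, `2` inert, `ρ̄₂` onto, odd Tamagawa), modulo the five prints.  I.e. under BSD₂ of the pair, for `Σ ≥ 3`
  every derived point `P(n)` on deep CM-inert Kolyvagin primes is `2`-divisible (Jetchev-type genus divisibility at `p = 2`): the W-UP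
  engine CANNOT be widened beyond `Σ ≤ 1` (this seat's `…ExactSumDefectLeOneAtTwo` is the line's whole reach), and the RESTATE option R2
  («conclusion `2^{2M₀+Σ−1}` from a deep certificate») is VACUOUS for `Σ ≥ 3` if BSD holds.
* `not_bsdp_of_grossWitness_of_two_le_sum_defect_of_prints` — the INSTRUMENT: on H₂, with BSD₂ of the rank-`0` CM twin discharged by
  PRINT (Burungale–Flach 2024 via `Rank1Residual.bsdp_cm_rankZero`, facts `bsdTriple_of_hasCM_of_L_one_ne_zero` + `exists_isNewformOf`), ONE
  frame over a Heegner field with `Σ ≥ 2` carrying a level-`4` Gross witness REFUTES `BSDp W 2` (modulo the prints).  g20's numerical target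
  («such a frame refutes 24277») is therefore a BSD test: as a computation it checks the kernel chain and the prints' typing, BSD predicting
  that no such frame exists.

References: [GrossZagier1986] V.§2; [GrossLMS1991] §2 Conj. (2.2), §4; [McCallumLMS1991] §5 Lemma 5.1, Thm. 5.4; [Milne1972ArithmeticAV] Thm. 1;
[DokchitserDokchitserAnnals2010] §2.1, Lemma 4.14; [Kramer1981] Prop. 3; [BurungaleFlach2024] Thm. 1.1, Cor. 2; [Jetchev2008] Thm. 1.1 (shape).
-/

set_option autoImplicit false
-- the Theorems namespace of this sub repeats the summit name by design (D-0017 nested layout)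
set_option linter.dupNamespace false

noncomputable section

open scoped Classical

open WeierstrassCurve NumberField Literature.NumberTheory.EllipticCurves
  Literature.NumberTheory.EllipticCurves.ModularForms
  Literature.NumberTheory.EllipticCurves.Rank1Residual
  Literature.NumberTheory.EllipticCurves.Rank1Residual.Typed
  Literature.NumberTheory.EllipticCurves.KrizLi2019
  Summit.BirchSwinnertonDyer.Rank1Residual
  Summit.BirchSwinnertonDyer.Rank1Residual.AdditivePotMult
open Literature.NumberTheory.EllipticCurves.GrossLMS1991 (prop37_2_reductionCongruence_inert)
open Summit.BirchSwinnertonDyer.BirchSwinnertonDyer.Theorems.CMExactDescent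

namespace Summit.BirchSwinnertonDyer.BirchSwinnertonDyer.Theorems.KolyvaginGenusTwo

/-! ## §1 The exact descent read backwards: BSD₂ of the pair gives the crux's value -/

/-- **`BSD₂(E) ∧ BSD₂(E^{(d_K)}) ⟹ #Ш(E_K)[2^∞] = 2^{2M₀}`, modulo GZ (all levels), GZK, modularity, Milne any-model.**  `W/ℚ` globally
minimal, `ρ̄_{E,2}` onto, `r_an(E) = 1`, odd Tamagawa product; `K` imaginary quadratic, `d_K` odd `≠ −3`, Heegner for `N_E`; a frame
`(Dt, β, ι)` with ODD Manin constant `Dt.c`; `y_K = P(1)` of infinite order with `2^{M₀} ∥ y_K` in `E(K[1])`; `Wd` a globally minimal model of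
`E^{(d_K)}`.  g0's `#Ш_an(W ⊗ K) = 4·[E(K):ℤP₀]²/(c²·w_K²·(∏c_ℓ)²)` has `ord₂ = 2M₀` (`w_K = 2`, `c`, `∏c_ℓ` odd, `ord₂[E(K):ℤP₀] = M₀`), and
`missingPPartOverCAt_baseChange_iff_bsdp` turns `BSDp W 2` (given `BSDp Wd 2`) into `ord₂ #Ш_an = ord₂ #Ш(E_K)`.  NO genus defect enters:
the crux's value is the conjecture's value for every admissible `K`. [cite: GrossZagier1986, V.§2 (pp. 310–312)]
[cite: McCallumLMS1991, §5 Lemma 5.1] [cite: Milne1972ArithmeticAV, §1 Thm. 1] [cite: DokchitserDokchitserAnnals2010, §2.1] -/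
theorem card_primaryComponent_sha_two_baseChange_eq_pow_of_bsdp_of_printedInputs
    (hGZ : ∀ (N : ℕ) [NeZero N] (W : WeierstrassCurve ℚ) (K : Type) [Field K] [NumberField K], gross_zagier N W K)
    (hGZK : rank_eq_analyticRank_of_analyticRank_le_one) (hmod : hasEntireLFunction_rat)
    (hMilneC : Milne1972.bsdQuotient_baseChange_quadratic_anyModel)
    (W : WeierstrassCurve ℚ) [W.IsElliptic] [W.IsGloballyMinimal] [NeZero (W.conductorNorm ℤ)]
    (hρ : W.HasSurjectiveModNGaloisRep 2) (hr : W.analyticRank = 1) (hT : Odd W.tamagawaProduct)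
    (K : Type) [Field K] [NumberField K] (hK : IsImaginaryQuadratic K) (hodd : Odd (NumberField.discr K))
    (h3 : NumberField.discr K ≠ -3) (hH : SatisfiesHeegnerHypothesis (W.conductorNorm ℤ) K)
    (Dt : ModularParametrizationData W (W.conductorNorm ℤ)) (hc : Odd Dt.c) (β : ℤ) (ι : K →+* ℂ)
    (d₁ : KolyvaginHeegnerData Dt β ι 1) (hy : ¬ IsOfFinAddOrder d₁.derivedPoint) (M₀ : ℕ)
    (hdiv : ∃ Q : (W.baseChange (ringClassField K ι 1)).toAffine.Point, ((2 ^ M₀ : ℕ) : ℤ) • Q = d₁.derivedPoint)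
    (hndiv : ¬ ∃ Q : (W.baseChange (ringClassField K ι 1)).toAffine.Point, ((2 ^ (M₀ + 1) : ℕ) : ℤ) • Q = d₁.derivedPoint)
    (Wd : WeierstrassCurve ℚ) [Wd.IsElliptic] [Wd.IsGloballyMinimal]
    (hWd : ∃ C : VariableChange ℚ, C • W.quadraticTwist (NumberField.discr K : ℚ) = Wd)
    (hBd : BSDp Wd 2) (hBW : BSDp W 2) :
    Nat.card (AddCommGroup.primaryComponent (W.baseChange K).sha 2) = 2 ^ (2 * M₀) := by
  haveI : Fact (Nat.Prime 2) := ⟨Nat.prime_two⟩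
  haveI hEK : (W.baseChange K).IsElliptic := isElliptic_baseChange' W K
  have h2 : Module.finrank ℚ K = 2 := hK.1
  have hD0 : (NumberField.discr K : ℚ) ≠ 0 := by exact_mod_cast NumberField.discr_ne_zero K
  haveI hEt : (W.quadraticTwist (NumberField.discr K : ℚ)).IsElliptic := W.isElliptic_quadraticTwist hD0
  obtain ⟨-, hDlt⟩ := discr_emod_four_and_lt_of_odd hK hodd h3
  have hw2 : Units.torsionOrder K = 2 :=
    Literature.NumberTheory.QuadraticFields.Quadratic.torsionOrder_eq_two_of_discr_lt_neg_four h2 hDlt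
  have hc0 : Dt.c ≠ 0 := by
    obtain ⟨k, hk⟩ := hc
    omega
  -- the Heegner point `P₀ ∈ E(K)` below `P(1)`
  obtain ⟨P₀, Hd, hP₀, hP₀K⟩ := exists_heegnerPoint_map_eq_derivedPoint_one hK hH d₁
  have hPinf : ¬ IsOfFinAddOrder P₀ := by
    intro hfin
    apply hy
    rw [← hP₀K]
    exact (WeierstrassCurve.Affine.Point.map (W' := W) (algebraMap K (ringClassField K ι 1)).toRatAlgHom).isOfFinAddOrder hfin
  -- the twin has analytic rank `0`
  have hLK : LDerivEK W K ≠ 0 :=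
    (lDerivEK_ne_zero_iff_not_isOfFinAddOrder W (W.conductorNorm ℤ) K (hGZ _ W K) hK hH ⟨Dt, Hd, ι, hP₀⟩).mpr hPinf
  have hL0 : W.entireLFunction 1 = 0 := entireLFunction_one_eq_zero_of_analyticRank_eq_one hr
  have hLt : (W.quadraticTwist (NumberField.discr K : ℚ)).entireLFunction 1 ≠ 0 := by
    intro h0
    apply hLK
    rw [lDerivEK_eq_deriv_mul W K hmod hL0, h0, mul_zero]
  have hrt : (W.quadraticTwist (NumberField.discr K : ℚ)).analyticRank = 0 :=
    ((W.quadraticTwist _).analyticRank_eq_zero_iff_holds (hmod _)).mpr hLt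
  have hrd : Wd.analyticRank = 0 := by
    obtain ⟨Cd, hCd⟩ := hWd
    rw [← hCd, analyticRank_smul, hrt]
  have hrK : (W.baseChange K).analyticRank = 1 :=
    (P2.analyticRank_baseChange_eq_one_iff W K hmod h2).mpr (Or.inl ⟨hr, hrt⟩)
  -- the exact identity over `K`
  obtain ⟨hrkK, hShaK, -, hshaC⟩ := shaAnOverC_baseChange_eq_of_heegner W K Dt Hd ι P₀ (hGZ _ W K) hGZK hmod hK hH hP₀ hc0 hrK
  haveI hfinK : Finite (W.baseChange K).sha := hShaK
  -- `ord₂ [E(K) : ℤP₀] = M₀`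
  have htor1 : ∀ (M : ℕ) (R : (W.baseChange (ringClassField K ι 1)).toAffine.Point), ((2 ^ M : ℕ) : ℤ) • R = 0 → R = 0 :=
    fun M R hR ↦ eq_zero_of_two_pow_smul_eq_zero_ringClassField W hK hodd hH hρ ι M R hR
  have hdivK : ∃ Q : (W.baseChange K).toAffine.Point, ((2 ^ M₀ : ℕ) : ℤ) • Q = P₀ :=
    (X11b.Three.Koly.pDiv_one_iff_exists_zsmul_eq hK d₁ P₀ hP₀K 2 M₀ (htor1 M₀)).mp hdiv
  have hndivK : ¬ ∃ Q : (W.baseChange K).toAffine.Point, ((2 ^ (M₀ + 1) : ℕ) : ℤ) • Q = P₀ :=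
    fun h ↦ hndiv ((X11b.Three.Koly.pDiv_one_iff_exists_zsmul_eq hK d₁ P₀ hP₀K 2 (M₀ + 1) (htor1 (M₀ + 1))).mpr h)
  have hiv : ∀ x : (W.baseChange K).toAffine.Point, 2 • x = 0 → x = 0 :=
    fun x hx ↦ eq_zero_of_two_smul_eq_zero_baseChange W hK hodd hH hρ x hx
  haveI : Finite (AddCommGroup.torsion (W.baseChange K).toAffine.Point) :=
    WeierstrassCurve.finite_torsion_point (W := W.baseChange K)
  obtain ⟨cc, Q, hcQ, hcker⟩ := X11b.RankOne.exists_coord_of_mordellWeilRank_eq_one (W.baseChange K) hrkK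
  have hidx : padicValNat 2 (AddSubgroup.zmultiples P₀).index = M₀ :=
    X11b.Three.Koly.padicValNat_index_zmultiples_eq_of_divisibility (p := 2) cc Q hcQ hcker hiv P₀ hdivK hndivK
  -- `ord₂ #Ш_an(W ⊗ K) = 2 M₀`
  set I := (AddSubgroup.zmultiples P₀).index with hI_def
  have hI0 : I ≠ 0 := fun hI ↦ by
    have hh := P2.torsionOrder_sq_mul_canonicalHeight_eq_index_sq_mul_regulator (W.baseChange K) hrkK P₀ hPinf
    rw [← hI_def, hI, Nat.cast_zero, zero_pow two_ne_zero, zero_mul, mul_eq_zero, pow_eq_zero_iff two_ne_zero, Nat.cast_eq_zero] at hh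
    exact hh.elim (W.baseChange K).torsionOrder_pos_holds.ne'
      (fun h0 ↦ hPinf ((Affine.Point.canonicalHeight_eq_zero_iff_holds P₀).mp h0))
  set q : ℚ := 4 * (I : ℚ) ^ 2 / ((Dt.c : ℚ) ^ 2 * (Units.torsionOrder K : ℚ) ^ 2 * ((W.tamagawaProduct : ℚ) ^ 2)) with hq_def
  have hcQ0 : (Dt.c : ℚ) ≠ 0 := by exact_mod_cast hc0
  have hcW0 : (W.tamagawaProduct : ℚ) ≠ 0 := by exact_mod_cast W.tamagawaProduct_pos_holds.ne'
  have hIQ0 : (I : ℚ) ≠ 0 := by exact_mod_cast hI0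
  have hq' : q = ((I : ℚ) / ((Dt.c : ℚ) * (W.tamagawaProduct : ℚ))) ^ 2 := by
    rw [hq_def, hw2]
    push_cast
    field_simp
    ring
  have hvc : padicValRat 2 (Dt.c : ℚ) = 0 := by
    rw [padicValRat.of_int, padicValInt.eq_zero_of_not_dvd (fun h2c ↦ (Int.not_even_iff_odd.mpr hc) (even_iff_two_dvd.mpr h2c))]
    rfl
  have hvcW : padicValRat 2 (W.tamagawaProduct : ℚ) = 0 := by
    rw [padicValRat.of_nat, padicValNat.eq_zero_of_not_dvd hT.not_two_dvd_nat]
    rfl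
  have hval : padicValRat 2 q = 2 * (M₀ : ℤ) := by
    rw [hq', padicValRat.pow, padicValRat.div hIQ0 (mul_ne_zero hcQ0 hcW0), padicValRat.mul hcQ0 hcW0, hvc, hvcW, padicValRat.of_nat,
      hidx]
    push_cast
    ring
  -- BSD₂ of the pair ⟹ `MissingPPartOverCAt (W ⊗ K) 2` ⟹ `ord₂ #Ш(E_K) = ord₂ #Ш_an = 2M₀`
  have hMiss : MissingPPartOverCAt (W.baseChange K) 2 :=
    (missingPPartOverCAt_baseChange_iff_bsdp W 2 K Wd hGZK hmod hMilneC hr.le h2 hWd (by rw [hrd]; exact zero_le_one) hBd).mpr hBW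
  obtain ⟨q', hq'C, hq'v⟩ := hMiss
  have hqq : q' = q := by
    have h := hq'C.symm.trans hshaC
    exact_mod_cast h
  rw [hqq, hval] at hq'v
  have hshaV : padicValNat 2 (Nat.card (AddCommGroup.primaryComponent (W.baseChange K).sha 2)) = 2 * M₀ := by
    rw [← X11b.Three.Koly.padicValNat_shaOrder_eq (W.baseChange K) 2]
    exact_mod_cast hq'v.symm
  obtain ⟨k, hk⟩ := Literature.NumberTheory.EllipticCurves.exists_natCard_primaryComponent_eq_pow
    (A := (W.baseChange K).sha) 2
  rw [hk, padicValNat.prime_pow] at hshaV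
  rw [hk, hshaV]

/-! ## §2 Under BSD₂ of the pair a level-4 Gross witness forces `Σ = 1` -/

/-- **`BSD₂(E^{(d_K)}) ∧ BSD₂(E) ∧` (level-`4` Gross witness) `⟹ Σ = 1`** on the habitat (CM, `2` inert in the CM field, `ρ̄_{E,2}` onto, odd
Tamagawa product; `K` imaginary quadratic with odd `d_K ≠ −3`, Heegner; a frame with odd Manin constant; `y_K` non-torsion, `2^{M₀} ∥ y_K`),
modulo GZ / GZK / modularity / Milne and Gross 1991 Prop. 3.7 (2): g20's `#Ш(E_K)(2)·2 = 2^{2M₀+Σ}` from the witness against §1's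
`#Ш(E_K)(2) = 2^{2M₀}` from BSD₂.  Contrapositive: under BSD₂ of the pair, for `Σ ≥ 3` (Σ is odd on the habitat) EVERY derived point on
deep CM-inert Kolyvagin primes is `2`-divisible — the genus analogue at `p = 2` of Jetchev's `m_∞ ≥ max ord_p c_q`.
[cite: McCallumLMS1991, §5 Thm. 5.4, Cor. 5.6] [cite: Kramer1981, Prop. 3] [cite: GrossLMS1991, Prop. 3.7 (2)] [cite: Milne1972ArithmeticAV, Thm. 1] -/
theorem sum_defect_eq_one_of_bsdp_of_grossWitness_of_printedInputs
    (hGZ : ∀ (N : ℕ) [NeZero N] (W : WeierstrassCurve ℚ) (K : Type) [Field K] [NumberField K], gross_zagier N W K)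
    (hGZK : rank_eq_analyticRank_of_analyticRank_le_one) (hmod : hasEntireLFunction_rat)
    (hMilneC : Milne1972.bsdQuotient_baseChange_quadratic_anyModel)
    (W : WeierstrassCurve ℚ) [W.IsElliptic] [W.IsGloballyMinimal] [NeZero (W.conductorNorm ℤ)]
    (hCM : W.HasCM) (hin : Rank1Residual.CMInert W 2) (hρ2 : W.HasSurjectiveModNGaloisRep 2) (hr : W.analyticRank = 1)
    (hT : Odd W.tamagawaProduct) (K : Type) [Field K] [NumberField K] (hIQ : IsImaginaryQuadratic K)
    (hodd : Odd (NumberField.discr K)) (h3 : NumberField.discr K ≠ -3) (hHe : SatisfiesHeegnerHypothesis (W.conductorNorm ℤ) K)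
    (h37 : prop37_2_reductionCongruence_inert (W.conductorNorm ℤ) W K)
    (Dt : ModularParametrizationData W (W.conductorNorm ℤ)) (hc : Odd Dt.c) (β : ℤ) (ι : K →+* ℂ) (d₁ : KolyvaginHeegnerData Dt β ι 1)
    (hy : ¬ IsOfFinAddOrder d₁.derivedPoint) (M₀ : ℕ)
    (hM₀ : ∃ Q : (W.baseChange (ringClassField K ι 1)).toAffine.Point, ((2 ^ M₀ : ℕ) : ℤ) • Q = d₁.derivedPoint)
    (hndiv : ¬ ∃ Q : (W.baseChange (ringClassField K ι 1)).toAffine.Point, ((2 ^ (M₀ + 1) : ℕ) : ℤ) • Q = d₁.derivedPoint)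
    {n₀ : ℕ} (hn₀ : Squarefree n₀)
    (hn₀K : ∀ q ∈ n₀.primeFactors, Zhang2014.IsKolyvaginPrime (W.conductorNorm ℤ) W K 2 q ∧ 2 ≤ Zhang2014.kolyvaginIndex W 2 q ∧
      FrobEqFrobInfty W K (2 ^ 2) q)
    (e₀ : KolyvaginHeegnerData Dt β ι n₀) (he₀ : addOrderOf (e₀.kolyvaginClass Nat.prime_two 2) = 2 ^ 2)
    (Wd : WeierstrassCurve ℚ) [Wd.IsElliptic] [Wd.IsGloballyMinimal]
    (hWd : ∃ C : VariableChange ℚ, C • W.quadraticTwist (NumberField.discr K : ℚ) = Wd)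
    (hBd : BSDp Wd 2) (hBW : BSDp W 2) :
    ∑ q ∈ (NumberField.discr K).natAbs.primeFactors,
        ((if jacobiSym W.Δ.num q = -1 then 1 else 0) +
          (if jacobiSym W.Δ.num q = 1 ∧ Even (W.frobeniusTrace q) then 2 else 0)) = 1 := by
  have hw := card_primaryComponent_sha_two_baseChange_mul_two_eq_of_grossWitness_of_printedInputs hGZ hGZK hmod hMilneC W hCM hin hρ2 hT
    K hIQ hodd h3 hHe h37 Dt β ι d₁ hy M₀ hM₀ hndiv (L := 2 * M₀ + 12) (k := 1) le_rfl le_rfl hn₀ hn₀K e₀ he₀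
  have hB := card_primaryComponent_sha_two_baseChange_eq_pow_of_bsdp_of_printedInputs hGZ hGZK hmod hMilneC W hρ2 hr hT K hIQ hodd h3 hHe Dt
    hc β ι d₁ hy M₀ hM₀ hndiv Wd hWd hBd hBW
  -- `2^{2M₀} · 2 = 2^{2M₀} · 2^{Σ}`
  rw [hB, pow_add] at hw
  have hpos : 0 < (2 : ℕ) ^ (2 * M₀) := pow_pos two_pos _
  have h2 : (2 : ℕ) ^ (∑ q ∈ (NumberField.discr K).natAbs.primeFactors,
      ((if jacobiSym W.Δ.num q = -1 then 1 else 0) +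
        (if jacobiSym W.Δ.num q = 1 ∧ Even (W.frobeniusTrace q) then 2 else 0))) = 2 ^ 1 := by
    rw [pow_one]
    exact (Nat.eq_of_mul_eq_mul_left hpos hw).symm
  exact Nat.pow_right_injective le_rfl h2

/-! ## §3 The instrument on H₂: a deep witness over a Heegner field with `Σ ≥ 2` refutes BSD₂(E) (BSD₂ of the twin being PRINT) -/

/-- **THE INSTRUMENT.**  On H₂ (CM, `2` inert in the CM field, `ρ̄_{E,2}` onto, `r_an(E) = 1`, odd Tamagawa product), `K` imaginary quadratic
with odd `d_K ≠ −3` and Heegner, a frame with odd Manin constant, `y_K` non-torsion with exponent `M₀`: BSD₂ of the rank-`0` CM twin is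
PRINT (Burungale–Flach 2024, `Rank1Residual.bsdp_cm_rankZero`, facts `bsdTriple_of_hasCM_of_L_one_ne_zero` and `exists_isNewformOf`; the twin
`Wd` of `CMSupply.exists_minimal_twin_hasCM_analyticRank_zero` has CM and `L(Wd, 1) ≠ 0` by Gross–Zagier since `y_K` is non-torsion), so
**a level-`4` Gross witness over a Heegner field with `Σ ≥ 2` contradicts `BSDp W 2`** — modulo GZ / GZK / Milne / Gross 3.7 (2) /
Burungale–Flach / modularity.  What g20's numerical target would test is BSD₂(E) itself (and the typing of the prints), not the crux.
[cite: BurungaleFlach2024, Thm. 1.1 and Cor. 2] [cite: McCallumLMS1991, §5 Thm. 5.4] [cite: Kramer1981, Prop. 3] [cite: GrossZagier1986, V.§2] -/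
theorem not_bsdp_of_grossWitness_of_two_le_sum_defect_of_prints
    (hGZ : ∀ (N : ℕ) [NeZero N] (W : WeierstrassCurve ℚ) (K : Type) [Field K] [NumberField K], gross_zagier N W K)
    (hGZK : rank_eq_analyticRank_of_analyticRank_le_one) (hnf : exists_isNewformOf)
    (hMilneC : Milne1972.bsdQuotient_baseChange_quadratic_anyModel) (hBF : bsdTriple_of_hasCM_of_L_one_ne_zero)
    (W : WeierstrassCurve ℚ) [W.IsElliptic] [W.IsGloballyMinimal] [NeZero (W.conductorNorm ℤ)]
    (hCM : W.HasCM) (hin : Rank1Residual.CMInert W 2) (hρ2 : W.HasSurjectiveModNGaloisRep 2) (hr : W.analyticRank = 1)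
    (hT : Odd W.tamagawaProduct) (K : Type) [Field K] [NumberField K] (hIQ : IsImaginaryQuadratic K)
    (hodd : Odd (NumberField.discr K)) (h3 : NumberField.discr K ≠ -3) (hHe : SatisfiesHeegnerHypothesis (W.conductorNorm ℤ) K)
    (h37 : prop37_2_reductionCongruence_inert (W.conductorNorm ℤ) W K)
    (Dt : ModularParametrizationData W (W.conductorNorm ℤ)) (hc : Odd Dt.c) (β : ℤ) (ι : K →+* ℂ) (d₁ : KolyvaginHeegnerData Dt β ι 1)
    (hy : ¬ IsOfFinAddOrder d₁.derivedPoint) (M₀ : ℕ)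
    (hM₀ : ∃ Q : (W.baseChange (ringClassField K ι 1)).toAffine.Point, ((2 ^ M₀ : ℕ) : ℤ) • Q = d₁.derivedPoint)
    (hndiv : ¬ ∃ Q : (W.baseChange (ringClassField K ι 1)).toAffine.Point, ((2 ^ (M₀ + 1) : ℕ) : ℤ) • Q = d₁.derivedPoint)
    {n₀ : ℕ} (hn₀ : Squarefree n₀)
    (hn₀K : ∀ q ∈ n₀.primeFactors, Zhang2014.IsKolyvaginPrime (W.conductorNorm ℤ) W K 2 q ∧ 2 ≤ Zhang2014.kolyvaginIndex W 2 q ∧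
      FrobEqFrobInfty W K (2 ^ 2) q)
    (e₀ : KolyvaginHeegnerData Dt β ι n₀) (he₀ : addOrderOf (e₀.kolyvaginClass Nat.prime_two 2) = 2 ^ 2)
    (hS2 : 2 ≤ ∑ q ∈ (NumberField.discr K).natAbs.primeFactors,
        ((if jacobiSym W.Δ.num q = -1 then 1 else 0) +
          (if jacobiSym W.Δ.num q = 1 ∧ Even (W.frobeniusTrace q) then 2 else 0))) :
    ¬ BSDp W 2 := by
  intro hBW
  have hmod : hasEntireLFunction_rat := hasEntireLFunction_rat_of_exists_isNewformOf hnf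
  have h2 : Module.finrank ℚ K = 2 := hIQ.1
  -- the twin has `L(E^{(d_K)}, 1) ≠ 0` (Gross–Zagier: `y_K` non-torsion ⟹ `L′(E/K, 1) ≠ 0 = L′(E,1)·L(E^{(d_K)},1)`)
  obtain ⟨P₀, Hd, hP₀, hP₀K⟩ := exists_heegnerPoint_map_eq_derivedPoint_one hIQ hHe d₁
  have hPinf : ¬ IsOfFinAddOrder P₀ := by
    intro hfin
    apply hy
    rw [← hP₀K]
    exact (WeierstrassCurve.Affine.Point.map (W' := W) (algebraMap K (ringClassField K ι 1)).toRatAlgHom).isOfFinAddOrder hfin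
  have hLK : LDerivEK W K ≠ 0 :=
    (lDerivEK_ne_zero_iff_not_isOfFinAddOrder W (W.conductorNorm ℤ) K (hGZ _ W K) hIQ hHe ⟨Dt, Hd, ι, hP₀⟩).mpr hPinf
  have hL0 : W.entireLFunction 1 = 0 := entireLFunction_one_eq_zero_of_analyticRank_eq_one hr
  have hLt : (W.quadraticTwist (NumberField.discr K : ℚ)).entireLFunction 1 ≠ 0 := by
    intro h0
    apply hLK
    rw [lDerivEK_eq_deriv_mul W K hmod hL0, h0, mul_zero]
  -- the globally minimal CM twin of analytic rank `0`, and its BSD₂ from PRINT (Burungale–Flach)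
  obtain ⟨Wd, _, _, hWd, hcmd, hrd⟩ := CMSupply.exists_minimal_twin_hasCM_analyticRank_zero hnf W hCM K hLt
  have hBd : BSDp Wd 2 := Rank1Residual.bsdp_cm_rankZero (p := 2) hBF hmod hcmd hrd
  have h1 := sum_defect_eq_one_of_bsdp_of_grossWitness_of_printedInputs hGZ hGZK hmod hMilneC W hCM hin hρ2 hr hT K hIQ hodd h3 hHe h37 Dt hc
    β ι d₁ hy M₀ hM₀ hndiv hn₀ hn₀K e₀ he₀ Wd hWd hBd hBW
  omega

end Summit.BirchSwinnertonDyer.BirchSwinnertonDyer.Theorems.KolyvaginGenusTwo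

end
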